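import Literature.MathematicalPhysics.QuantumFieldTheory.Balaban1983to89.B9Thm37AllNormsTwoSided

/-!
# `Balaban1983to89.B9SectBAllNorms` — [B9] Sect. B, pp. 402–403: «applying Theorem 3.1 for G′(U), the bound (3.63), the
# representation (3.64) and Lemma 2.1 of [4] we can prove all the statements (3.42)–(3.47) of Theorem 3.1 for the
# operator G′(U′U)» — the Neumann series (3.64)/(3.65) summed with ARBITRARY block norms at both ends (left, right and
# two-sided members), and the remainders of (3.65) «with the additional small factor O(1)α₁» (generic layer; sequel of
# `…B9Thm37AllNorms*`)

T. Bałaban, *Propagators for lattice gauge theories in a background field*, Commun. Math. Phys. **99**, 389–434 (1985)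
[Balaban1985BackgroundPropagators] (cell paper B9; journal page = PDF page + 388); [4] = [Balaban1984PropagatorsII].

statement-level skeleton of published theorems with citation tags; proofs where landed; nothing here is a claim about the Yang–Mills mass gap

CITATION HEADER (lean-in-tree rule).  THE PRINTED LOCI (p. 402 [PDF 14] – p. 403 [PDF 15], read on the held text
`paper:balaban1985-cmp99-background-propagators` p0014/p0015; the same spans are certified in the headers of the cell's
Sect. B lineage `…B9Eq360Vprime`, `…B9Ineq363Vprime`, `…B9Thm34AllFinal` (lit-balaban r06)): (3.60) *"Δ_{U′U} + Q′*(U′U)aQ′(U′U)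
= Δ_U + Q′*(U)aQ′(U) − V′(A), where V′(A) is defined by the last equality"*; (3.61) *"|(V′(A)λ)(x)| ≤ O(1)α₁((L^jη)^{−1}|∇_Uλ|
+ (L^jη)^{−2}|λ|)"*; *"We assume that Theorem 3.1 is valid for the operator G′(U). The equality (3.60) can be written as
Δ_{U′U} + Q′*(U′U)aQ′(U′U) = (I − V′(A)G′(U))(Δ_U + Q′*(U)aQ′(U)), (3.62) and the operator V′(A)G′(U) satisfies the bound
|(V′(A)G′(U)λ)(x)| ≤ O(1)B₀α₁e^{−δ₀d(y,y′)}|λ| (3.63) for x ∈ Δ(y), supp λ ⊂ Δ(y′) … Thus for α₁ sufficiently small the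
norm of this operator is small and I − V′(A)G′(U) is an invertible operator, the inverse is given by a convergent Neumann
series. This implies the existence of the operator G′(U′U) and the equality G′(U′U) = G′(U)(I − V′(A)G′(U))^{−1} =
Σ_{n=0}^∞ G′(U)(V′(A)G′(U))ⁿ. (3.64) … G′(U′U) = G′(U) + G′(U)V′(A)G′(U′U) = G′(U) + G′(U′U)V′(A)G′(U), (3.65) and
norms of the second operators on the right-hand sides are small. Now applying Theorem 3.1 for G′(U), the bound (3.63),
the representation (3.64) and Lemma 2.1 of [4] we can prove all the statements (3.42)–(3.47) of Theorem 3.1 for the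
operator G′(U′U), of course with different constants, although changes are small. … This allows us to formulate a
statement concerning the remainders G′(U)V′(A)G′(U′U) and G′(U′U)V′(A)G′(U) in (3.65). They satisfy Theorem 3.1 with
the additional small factor O(1)α₁."*

WHAT THE TREE HAD.  The cell's Sect. B programme (`…B9Thm34AllFinal`, `…B9Thm34AllKernelFinal`, `…B9Thm34HolderAllFinal`,
`…B9Thm34HolderInputG`, FILES 20–37 of lit-balaban r06) proves the sup, kernel and Hölder members of Theorem 3.4 for the
concrete perturbation V′(A) of (3.60) on the lineage's letter carriers; its census (`B9-CLOSURE.md` §3 item 1 (ii), §5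
item 3 (O)) records as NOT in the kernel the L² members (3.46) of the extended operators and the input-Hölder members of
G′(U′U) — for want of a Neumann bookkeeping in those norms.

WHAT THIS FILE CERTIFIES (0 sorry; theorems only; no `def`).  The sentence *"applying Theorem 3.1 for G′(U), the bound
(3.63), the representation (3.64) and Lemma 2.1"* over ARBITRARY block norms (`B11SectG.BlockNorm`/`HasMaj`), by the
Neumann lemmas of `…B9Thm37AllNorms` (right form), `…B9Thm37AllNormsRight` (left form, conjugated weights) and
`…B9Thm37AllNormsTwoSided` (series form) — so that the block-L² members (`B9SectDL2Decay.l2w`), the Hölder members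
(probe lattices, `B9Thm37AllNormsInstances.hasMaj_probe_iff`) and the sup members are ONE statement each:
* §1 (3.62)/(3.65) as ring identities: `resolvent_right_fix` (Δ′ = Δ − V, ΔG = 1, G′Δ′ = 1 ⇒ G′ = G + G′(VG)),
  `resolvent_left_fix` (GΔ = 1, Δ′G′ = 1 ⇒ G′ = G + (GV)G′).
* §2 (3.61) + Thm 3.1 ⇒ (3.63), abstractly: `hasMaj_local_after_decay` — a LOCAL operator V (majorant K_V with the weighted
  row sum Σ_{y″}K_V(y,y″)W(y″)e^{δ₀d(y,y″)} ≤ α_V·W(y)) after an operator with majorant B·W(y)·e^{−δ₀d} has majorant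
  κ·α_V·B·W(y)·e^{−δ₀d} — the printed O(1)B₀α₁.
* §3 **`sectB_left`** — every LEFT member EG′(U′U) from `b₁` into `b₂` (E = 1, ∇_U, Δ_U, Hölder probes, L²-readings): from
  Theorem 3.1's E-member for G′(U) (`hEG`: A·W(y)e^{−δ₀d}), (3.63) in `b₁` (`h363`: θe^{−δ₀d}), the two inverses and
  (3.60), Lemma 2.1 at α and κ₁θc₁(α) < 1 (*"for α₁ sufficiently small"*): EG′(U′U) has majorant
  A·c₁(α)(1 − κ₁θc₁(α))⁻¹·W(y)·e^{−(1−α)δ₀d}; **`sectB_left_remainder`** — the remainder E·G′(U′U)V′(A)G′(U) of (3.65)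
  *"with the additional small factor"* κ₁θc₁(α).
* §4 **`sectB_right`** — every RIGHT member G′(U′U)A from `b₀` into `b₁` ((3.42)₃, (3.46)₃): from the A-member of G′(U)
  (`hGA`: A·W(y)Q(y′)e^{−δ₀d}) and G′(U)V′(A) in the CONJUGATED shape θ·(W(y)/W(y′))e^{−δ₀d} (`hGV`; V′ in divergence
  form against the right members of G′(U)), d symmetric: majorant A·c₁(α)(1 − κ₁θc₁(α))⁻¹W(y)Q(y′)e^{−(1−α)δ₀d}.
* §5 **`sectB_twoSided`** — every TWO-SIDED member EG′(U′U)A ((3.44)–(3.45), (3.46)₄) by `B9Thm37AllNormsTwoSided.twoSided_series`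
  with G₀ := G′(U), R′ := V′(A)G′(U): rate (1 − 2α)δ₀, junction weight moved by a (2.60)-type transfer.

HONEST SCOPE.  Generic layer only: V′(A), its bound (3.61)/(3.63) in the chosen norm, Theorem 3.1's members for G′(U),
the existence of the two-sided inverses and the a-priori bounds are HYPOTHESES of the printed shape (the cell's letter
files supply them in the sup/Hölder sizes; the block-L² letters (3.46) for G′(U) and an L² form of (3.61) are the
remaining concrete inputs for r06's item (O)); analyticity in A (the other half of Theorem 3.4) is not touched; nothing
about (3.65)–(3.67) ((Q′G′²Q′*)⁻¹) or (3.84)–(3.86) (G) beyond the remark that they are the same lemmas with other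
letters.  Value = kernel-checked bookkeeping of a printed *"we can prove all the statements"*, NOT summit progress; nothing
continuum, nothing about the mass gap.  Seat `pub-ymgap-dag-n06-b` (HUMAN RULING D-0062, node N06), 2026-08-25; rows
B9.Thm3.4 × B9.Eq3.62–3.65 × (3.43)/(3.46) (cells only).
-/

namespace Literature.MathematicalPhysics.QuantumFieldTheory.Balaban1983to89.B9SectBAllNorms

open Literature.MathematicalPhysics.QuantumFieldTheory.Balaban1983to89
open Finset B6RandomWalk B11SectG B9Thm37AllNorms B9Thm37AllNormsRight B9Thm37AllNormsTwoSided

noncomputable section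

/-! ## §1  (3.62)/(3.65): the resolvent identities from the two inverses -/

section Algebra

/-- **(3.65), right form**: Δ′ = Δ − V ((3.60)/(3.62)), ΔG = 1 and G′Δ′ = 1 give G′ = G + G′(VG) — *"G′(U′U) = G′(U) +
G′(U′U)V′(A)G′(U)"*. [cite: Balaban1985BackgroundPropagators, (3.62)–(3.65) p.402] -/
theorem resolvent_right_fix {A : Type*} [Ring A] {Δ Δ' V G G' : A} (h360 : Δ' = Δ - V) (hG : Δ * G = 1)
    (hG' : G' * Δ' = 1) : G' = G + G' * (V * G) := by
  have h1 : G' * (V * G) = G' - G := by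
    have hV : V = Δ - Δ' := by rw [h360]; abel
    calc G' * (V * G) = G' * ((Δ - Δ') * G) := by rw [hV]
      _ = G' * (Δ * G) - (G' * Δ') * G := by rw [sub_mul, mul_sub, mul_assoc]
      _ = G' - G := by rw [hG, hG', mul_one, one_mul]
  rw [h1, add_sub_cancel]

/-- **(3.65), left form**: Δ′ = Δ − V, GΔ = 1 and Δ′G′ = 1 give G′ = G + (GV)G′ — *"G′(U′U) = G′(U) + G′(U)V′(A)G′(U′U)"*.
[cite: Balaban1985BackgroundPropagators, (3.64)–(3.65) p.402] -/
theorem resolvent_left_fix {A : Type*} [Ring A] {Δ Δ' V G G' : A} (h360 : Δ' = Δ - V) (hG : G * Δ = 1)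
    (hG' : Δ' * G' = 1) : G' = G + (G * V) * G' := by
  have h1 : (G * V) * G' = G' - G := by
    have hV : V = Δ - Δ' := by rw [h360]; abel
    calc (G * V) * G' = G * ((Δ - Δ') * G') := by rw [hV, mul_assoc]
      _ = (G * Δ) * G' - G * (Δ' * G') := by rw [sub_mul, mul_sub, mul_assoc]
      _ = G' - G := by rw [hG, hG', mul_one, one_mul]
  rw [h1, add_sub_cancel]

end Algebra

/-! ## §2  (3.61) + Theorem 3.1 ⇒ (3.63): a local operator after a decaying one -/

section Local

variable {G : B6.Geometry}
variable {F₁ F₂ F₃ : Type} [AddCommGroup F₁] [Module ℝ F₁] [AddCommGroup F₂] [Module ℝ F₂]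
  [AddCommGroup F₃] [Module ℝ F₃]

/-- **(3.61) + (3.42) ⇒ (3.63), over block norms**: a LOCAL operator V : F₂ → F₃ (majorant K_V ≥ 0 from `b₂` into `b₃`
whose weighted row sums obey Σ_{y″}K_V(y,y″)·W(y″)·e^{δ₀d(y,y″)} ≤ α_V·W(y) — for (3.61): K_V(y,y″) = O(1)α₁ for the few
y″ near y, the powers (L^jη)^{−1}, (L^jη)^{−2} being carried by the local sizes of `b₂`) after an operator T : F₁ → F₂
with majorant B·W(y)·e^{−δ₀d(y,y′)} from `b₁` into `b₂` (Theorem 3.1 for G′(U) read into `b₂`) has majorant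
κ₂·α_V·B·W(y)·e^{−δ₀d(y,y′)} — *"|(V′(A)G′(U)λ)(x)| ≤ O(1)B₀α₁e^{−δ₀d(y,y′)}|λ|"*.
[cite: Balaban1985BackgroundPropagators, (3.61)–(3.63) p.402] -/
theorem hasMaj_local_after_decay (b₁ : BlockNorm G F₁) (b₂ : BlockNorm G F₂) (b₃ : BlockNorm G F₃)
    {V : F₂ →ₗ[ℝ] F₃} {T : F₁ →ₗ[ℝ] F₂} {K_V : G.Site → G.Site → ℝ} (δ₀ αV B : ℝ) (W : G.Site → ℝ)
    (hKV : ∀ a c, 0 ≤ K_V a c) (hB : 0 ≤ B) (hW : ∀ y, 0 ≤ W y) (hδ₀ : 0 ≤ δ₀) (htri : Triangle254 G)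
    (hrow : ∀ a : G.Site, ∑ y'' : G.Site, K_V a y'' * W y'' * Real.exp (δ₀ * G.dist a y'') ≤ αV * W a)
    (hV : HasMaj b₂ b₃ V K_V) (hT : HasMaj b₁ b₂ T (fun a c => B * W a * Real.exp (-(δ₀ * G.dist a c)))) :
    HasMaj b₁ b₃ (V ∘ₗ T) (fun a c => b₂.κ * αV * B * W a * Real.exp (-(δ₀ * G.dist a c))) := by
  refine (hasMaj_comp hV hT hKV).mono fun a c => ?_
  have hterm : ∀ y'' : G.Site, K_V a y'' * (b₂.κ * (B * W y'' * Real.exp (-(δ₀ * G.dist y'' c)))) ≤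
      b₂.κ * B * Real.exp (-(δ₀ * G.dist a c)) * (K_V a y'' * W y'' * Real.exp (δ₀ * G.dist a y'')) := by
    intro y''
    have hexp : Real.exp (-(δ₀ * G.dist y'' c)) ≤ Real.exp (-(δ₀ * G.dist a c)) * Real.exp (δ₀ * G.dist a y'') := by
      rw [← Real.exp_add]
      refine Real.exp_le_exp.mpr ?_
      have := mul_le_mul_of_nonneg_left (htri a y'' c) hδ₀
      nlinarith
    have hnn : 0 ≤ K_V a y'' * (b₂.κ * (B * W y'')) :=
      mul_nonneg (hKV a y'') (mul_nonneg b₂.κ_nonneg (mul_nonneg hB (hW y'')))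
    calc K_V a y'' * (b₂.κ * (B * W y'' * Real.exp (-(δ₀ * G.dist y'' c))))
        = K_V a y'' * (b₂.κ * (B * W y'')) * Real.exp (-(δ₀ * G.dist y'' c)) := by ring
      _ ≤ K_V a y'' * (b₂.κ * (B * W y'')) * (Real.exp (-(δ₀ * G.dist a c)) * Real.exp (δ₀ * G.dist a y'')) :=
          mul_le_mul_of_nonneg_left hexp hnn
      _ = _ := by ring
  calc ∑ y'' : G.Site, K_V a y'' * (b₂.κ * (B * W y'' * Real.exp (-(δ₀ * G.dist y'' c))))
      ≤ ∑ y'' : G.Site, b₂.κ * B * Real.exp (-(δ₀ * G.dist a c)) *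
          (K_V a y'' * W y'' * Real.exp (δ₀ * G.dist a y'')) := Finset.sum_le_sum fun y'' _ => hterm y''
    _ = b₂.κ * B * Real.exp (-(δ₀ * G.dist a c)) *
          ∑ y'' : G.Site, K_V a y'' * W y'' * Real.exp (δ₀ * G.dist a y'') := by rw [Finset.mul_sum]
    _ ≤ b₂.κ * B * Real.exp (-(δ₀ * G.dist a c)) * (αV * W a) :=
        mul_le_mul_of_nonneg_left (hrow a) (mul_nonneg (mul_nonneg b₂.κ_nonneg hB) (Real.exp_nonneg _))
    _ = _ := by ring

end Local

/-! ## §3  LEFT members of (3.42)–(3.47) for G′(U′U): the right form of (3.65) -/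

section Left

variable {G : B6.Geometry}
variable {F₁ F₂ : Type} [AddCommGroup F₁] [Module ℝ F₁] [AddCommGroup F₂] [Module ℝ F₂]

/-- **«all the statements (3.42)–(3.47) of Theorem 3.1 for the operator G′(U′U)», LEFT members** (p. 403): for a linear
reading E : F₁ → F₂ into any block norm `b₂` (E = 1, ∇_U, Δ_U: (3.42)₁,₂,₄; Hölder probes: (3.43); block-L² readings:
(3.46)₁,₂,₅; weighted: (3.47)), Theorem 3.1's E-member for G = G′(U) (`hEG`), the bound (3.63) for VG = V′(A)G′(U) in
`b₁` (`h363`), the operators Δ = Δ′_a(U), Δ′ = Δ − V = Δ′_a(U′U) with ΔG = 1 and G′Δ′ = 1 (G′ = G′(U′U)), Lemma 2.1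
of [4] at α and κ₁θc₁(α) < 1 (*"for α₁ sufficiently small"*) and an a-priori constant majorant of EG′ give EG′(U′U)
the majorant A·c₁(α)·(1 − κ₁θc₁(α))⁻¹·W(y)·e^{−(1−α)δ₀d(y,y′)} — *"of course with different constants"*.
[cite: Balaban1985BackgroundPropagators, (3.62)–(3.65) pp.402–403, Thm 3.4 p.400] -/
theorem sectB_left (b₁ : BlockNorm G F₁) (b₂ : BlockNorm G F₂) (E : F₁ →ₗ[ℝ] F₂) (d : ℕ) (δ₀ α θ A M₀ : ℝ)
    (W : G.Site → ℝ) {Δ Δ' V Gop G' : Module.End ℝ F₁}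
    (hA : 0 ≤ A) (hW : ∀ y, 0 ≤ W y) (hθ : 0 ≤ θ) (hM₀ : 0 ≤ M₀) (hαδ : 0 ≤ α * δ₀) (h1αδ : 0 ≤ (1 - α) * δ₀)
    (htri : Triangle254 G) (hrefl : ∀ y : G.Site, G.dist y y = 0) (hdnn : ∀ y y' : G.Site, 0 ≤ G.dist y y')
    (h261 : Ineq261 d G δ₀ α) (h263 : Ineq263 d G δ₀ α) (hsmall : b₁.κ * θ * B6.c1 d δ₀ α < 1)
    (h360 : Δ' = Δ - V) (hG : Δ * Gop = 1) (hG' : G' * Δ' = 1)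
    (hEG : HasMaj b₁ b₂ (E ∘ₗ Gop) (fun a c => A * W a * Real.exp (-(δ₀ * G.dist a c))))
    (h363 : HasMaj b₁ b₁ (V * Gop) (fun a c => θ * Real.exp (-(δ₀ * G.dist a c))))
    (hap : HasMaj b₁ b₂ (E ∘ₗ G') (fun _ _ => M₀)) :
    HasMaj b₁ b₂ (E ∘ₗ G')
      (fun a c => A * B6.c1 d δ₀ α * (1 - b₁.κ * θ * B6.c1 d δ₀ α)⁻¹ * W a *
        Real.exp (-((1 - α) * δ₀ * G.dist a c))) := by
  have hfix : G' = Gop + G' * (V * Gop) := resolvent_right_fix h360 hG hG'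
  have hfixE : ∀ ν, (E ∘ₗ G') ν = (E ∘ₗ Gop) ν + (E ∘ₗ G') ((V * Gop) ν) := by
    intro ν
    have h := congrArg (fun T : Module.End ℝ F₁ => E (T ν)) hfix
    simpa only [LinearMap.comp_apply, LinearMap.add_apply, Module.End.mul_apply, map_add] using h
  exact neumann_right b₁ b₂ d δ₀ α θ A M₀ W hA hW hθ hM₀ hαδ h1αδ htri hrefl hdnn h261 h263 hsmall hEG h363 hfixE hap

/-- **The remainder of (3.65) «with the additional small factor»** (p. 403: *"the remainders G′(U)V′(A)G′(U′U) and
G′(U′U)V′(A)G′(U) in (3.65) … satisfy Theorem 3.1 with the additional small factor O(1)α₁"*): with the conclusion of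
`sectB_left` for EG′(U′U) (any majorant A′W(y)e^{−(1−α)δ₀d}) and (3.63) for V′(A)G′(U), the left member of the
remainder E·G′(U′U)V′(A)G′(U) has majorant (κ₁θc₁(α))·A′·W(y)·e^{−(1−α)δ₀d(y,y′)} (d symmetric: the column convolution).
[cite: Balaban1985BackgroundPropagators, (3.65) p.402, p.403] -/
theorem sectB_left_remainder (b₁ : BlockNorm G F₁) (b₂ : BlockNorm G F₂) (E : F₁ →ₗ[ℝ] F₂) (d : ℕ) (δ₀ α θ A' : ℝ)
    (W : G.Site → ℝ) {V Gop G' : Module.End ℝ F₁}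
    (hA' : 0 ≤ A') (hW : ∀ y, 0 ≤ W y) (hθ : 0 ≤ θ) (h1αδ : 0 ≤ (1 - α) * δ₀)
    (htri : Triangle254 G) (hdnn : ∀ y y' : G.Site, 0 ≤ G.dist y y')
    (hsymm : ∀ a c : G.Site, G.dist a c = G.dist c a) (h261 : Ineq261 d G δ₀ α)
    (hEG' : HasMaj b₁ b₂ (E ∘ₗ G') (fun a c => A' * W a * Real.exp (-((1 - α) * δ₀ * G.dist a c))))
    (h363 : HasMaj b₁ b₁ (V * Gop) (fun a c => θ * Real.exp (-(δ₀ * G.dist a c)))) :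
    HasMaj b₁ b₂ (E ∘ₗ (G' * (V * Gop)))
      (fun a c => b₁.κ * θ * B6.c1 d δ₀ α * A' * W a * Real.exp (-((1 - α) * δ₀ * G.dist a c))) := by
  have h := hasMaj_comp hEG' h363 (fun a c => mul_nonneg (mul_nonneg hA' (hW a)) (Real.exp_nonneg _))
  have hrow : RowSum G (α * δ₀) (B6.c1 d δ₀ α) := (rowSum_iff_ineq261 d G δ₀ α).mp h261
  refine (h.congr fun μ => ?_).mono fun a c => ?_
  · simp only [LinearMap.comp_apply, Module.End.mul_apply]
  · have hconv := conv_col_le (G := G) ((1 - α) * δ₀) δ₀ (α * δ₀) (B6.c1 d δ₀ α) (A' * W a) (b₁.κ * θ)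
      (mul_nonneg hA' (hW a)) (mul_nonneg b₁.κ_nonneg hθ) h1αδ (by linarith) htri hdnn hsymm hrow a c
    calc ∑ y'', A' * W a * Real.exp (-((1 - α) * δ₀ * G.dist a y'')) * (b₁.κ * (θ * Real.exp (-(δ₀ * G.dist y'' c))))
        = ∑ y'', A' * W a * Real.exp (-((1 - α) * δ₀ * G.dist a y'')) * (b₁.κ * θ * Real.exp (-(δ₀ * G.dist y'' c))) :=
          Finset.sum_congr rfl fun y'' _ => by ring
      _ ≤ A' * W a * (b₁.κ * θ) * B6.c1 d δ₀ α * Real.exp (-((1 - α) * δ₀ * G.dist a c)) := hconv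
      _ = _ := by ring

end Left

/-! ## §4  RIGHT members of (3.42)–(3.47) for G′(U′U): the left form of (3.65) with conjugated weights -/

section Right

variable {G : B6.Geometry}
variable {F₀ F₁ : Type} [AddCommGroup F₀] [Module ℝ F₀] [AddCommGroup F₁] [Module ℝ F₁]

/-- **RIGHT members for G′(U′U)** ((3.42)₃ G′(U′U)∇*_U, (3.46)₃; p. 403 *"all the statements (3.42)–(3.47)"*): from the
A-member of G = G′(U) (`hGA`: A·W(y)Q(y′)e^{−δ₀d} from `b₀` into `b₁`), the operator GV = G′(U)V′(A) in the CONJUGATED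
shape θ·(W(y)/W(y′))e^{−δ₀d} in `b₁` (`hGV`: V′ in divergence form against the right members of G′(U), its coefficients
O(α₁)(L^{j′}η)^{−1}, (L^{j′}η)^{−2} against the output powers of G′(U) — the shape `B9Thm37Glue.rightR_cube_majorant`
delivers), GΔ = 1, Δ′G′ = 1, Δ′ = Δ − V, Lemma 2.1 at α with a symmetric distance, κ₁θc₁(α) < 1 and an a-priori bound:
G′(U′U)A has majorant A·c₁(α)(1 − κ₁θc₁(α))⁻¹·W(y)Q(y′)·e^{−(1−α)δ₀d(y,y′)}.
[cite: Balaban1985BackgroundPropagators, (3.64)–(3.65) pp.402–403, (3.42) p.397, p.398] -/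
theorem sectB_right (b₀ : BlockNorm G F₀) (b₁ : BlockNorm G F₁) (Aop : F₀ →ₗ[ℝ] F₁) (d : ℕ) (δ₀ α θ A M₀ : ℝ)
    (W Q : G.Site → ℝ) {Δ Δ' V Gop G' : Module.End ℝ F₁}
    (hA : 0 ≤ A) (hW : ∀ y, 0 < W y) (hQ : ∀ y, 0 ≤ Q y) (hθ : 0 ≤ θ) (hM₀ : 0 ≤ M₀) (hαδ : 0 ≤ α * δ₀)
    (h1αδ : 0 ≤ (1 - α) * δ₀) (htri : Triangle254 G) (hrefl : ∀ y : G.Site, G.dist y y = 0)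
    (hdnn : ∀ y y' : G.Site, 0 ≤ G.dist y y') (hsymm : ∀ a c : G.Site, G.dist a c = G.dist c a)
    (h261 : Ineq261 d G δ₀ α) (h263 : Ineq263 d G δ₀ α) (hsmall : b₁.κ * θ * B6.c1 d δ₀ α < 1)
    (h360 : Δ' = Δ - V) (hG : Gop * Δ = 1) (hG' : Δ' * G' = 1)
    (hGA : HasMaj b₀ b₁ (Gop ∘ₗ Aop) (fun a c => A * W a * Q c * Real.exp (-(δ₀ * G.dist a c))))
    (hGV : HasMaj b₁ b₁ (Gop * V) (fun a c => θ * (W a / W c) * Real.exp (-(δ₀ * G.dist a c))))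
    (hap : HasMaj b₀ b₁ (G' ∘ₗ Aop) (fun _ _ => M₀)) :
    HasMaj b₀ b₁ (G' ∘ₗ Aop)
      (fun a c => A * B6.c1 d δ₀ α * (1 - b₁.κ * θ * B6.c1 d δ₀ α)⁻¹ * W a * Q c *
        Real.exp (-((1 - α) * δ₀ * G.dist a c))) := by
  have hfix : G' = Gop + (Gop * V) * G' := resolvent_left_fix h360 hG hG'
  have hfixA : G' ∘ₗ Aop = Gop ∘ₗ Aop + (Gop * V) ∘ₗ (G' ∘ₗ Aop) := by
    conv_lhs => rw [hfix]
    rw [LinearMap.add_comp, Module.End.mul_eq_comp, LinearMap.comp_assoc]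
  exact neumann_left_weighted b₀ b₁ d δ₀ α θ A M₀ W Q hA hW hQ hθ hM₀ hαδ h1αδ htri hrefl hdnn hsymm h261 h263 hsmall
    hGA hGV hfixA hap

end Right

/-! ## §5  TWO-SIDED members of (3.42)–(3.47) for G′(U′U): the series (3.64) -/

section TwoSided

variable {G : B6.Geometry}
variable {F₀ F₁ F₂ : Type} [AddCommGroup F₀] [Module ℝ F₀] [AddCommGroup F₁] [Module ℝ F₁]
  [AddCommGroup F₂] [Module ℝ F₂]

/-- **TWO-SIDED members for G′(U′U)** ((3.44)–(3.45) ∇_UG′(U′U)∇*_U, (3.46)₄; p. 403), along the series (3.64) written as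
EG′(U′U)A = Σₙ EG′(U)(V′G′(U))ⁿA: from Theorem 3.1's E-member (`hEG`) and two-sided member (`hEGA`) for G′(U), (3.63) in
`b₁` (`h363`) and (3.63) composed with A (`h363A`: θ_A·V(y)·Q(y′)e^{−δ₀d} — the junction weight V is moved to the output
end by the (2.60)-type transfer `htransfer`), Δ′ = Δ − V, ΔG = 1, G′Δ′ = 1, Lemma 2.1 at α (d symmetric), κ₁θc₁(α) < 1
and an a-priori bound of EG′(U′U): EG′(U′U)A has majorant
(A₂W₀(y) + A₁κ₁θ_AC_Tc₁(α)²(1 − κ₁θc₁(α))⁻¹W(y)V′(y))·Q(y′)·e^{−(1−2α)δ₀d(y,y′)}.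
[cite: Balaban1985BackgroundPropagators, (3.64)–(3.65) pp.402–403, (3.44)–(3.46) p.398] -/
theorem sectB_twoSided (b₀ : BlockNorm G F₀) (b₁ : BlockNorm G F₁) (b₂ : BlockNorm G F₂)
    (E : F₁ →ₗ[ℝ] F₂) (Aop : F₀ →ₗ[ℝ] F₁) (d : ℕ) (δ₀ α θ θA A₁ A₂ C_T M₀ : ℝ) (W W₀ Vw V' Q : G.Site → ℝ)
    {Δ Δ' V Gop G' : Module.End ℝ F₁}
    (hθ : 0 ≤ θ) (hθA : 0 ≤ θA) (hA₁ : 0 ≤ A₁) (hA₂ : 0 ≤ A₂) (hC : 0 ≤ C_T) (hM₀ : 0 ≤ M₀)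
    (hW : ∀ y, 0 ≤ W y) (hW₀ : ∀ y, 0 ≤ W₀ y) (hVw : ∀ y, 0 ≤ Vw y) (hV' : ∀ y, 0 ≤ V' y) (hQ : ∀ y, 0 ≤ Q y)
    (hαδ : 0 ≤ α * δ₀) (h2αδ : 0 ≤ (1 - 2 * α) * δ₀)
    (htri : Triangle254 G) (hrefl : ∀ y : G.Site, G.dist y y = 0) (hdnn : ∀ y y' : G.Site, 0 ≤ G.dist y y')
    (hsymm : ∀ a c : G.Site, G.dist a c = G.dist c a) (h261 : Ineq261 d G δ₀ α) (h263 : Ineq263 d G δ₀ α)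
    (hsmall : b₁.κ * θ * B6.c1 d δ₀ α < 1)
    (h360 : Δ' = Δ - V) (hG : Δ * Gop = 1) (hG' : G' * Δ' = 1)
    (hEG : HasMaj b₁ b₂ (E ∘ₗ Gop) (fun a c => A₁ * W a * Real.exp (-(δ₀ * G.dist a c))))
    (hEGA : HasMaj b₀ b₂ (E ∘ₗ Gop ∘ₗ Aop) (fun a c => A₂ * W₀ a * Q c * Real.exp (-(δ₀ * G.dist a c))))
    (h363 : HasMaj b₁ b₁ (V * Gop) (fun a c => θ * Real.exp (-(δ₀ * G.dist a c))))
    (h363A : HasMaj b₀ b₁ ((V * Gop) ∘ₗ Aop) (fun a c => θA * Vw a * Q c * Real.exp (-(δ₀ * G.dist a c))))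
    (htransfer : ∀ a y'' : G.Site, Vw y'' * Real.exp (-(α * δ₀ * G.dist a y'')) ≤ C_T * V' a)
    (hap : HasMaj b₁ b₂ (E ∘ₗ G') (fun _ _ => M₀)) :
    HasMaj b₀ b₂ (E ∘ₗ G' ∘ₗ Aop)
      (fun a c => (A₂ * W₀ a + A₁ * b₁.κ * θA * C_T * B6.c1 d δ₀ α ^ 2 *
          (1 - b₁.κ * θ * B6.c1 d δ₀ α)⁻¹ * W a * V' a) * Q c *
        Real.exp (-((1 - 2 * α) * δ₀ * G.dist a c))) := by
  have hfix : G' = Gop + G' * (V * Gop) := resolvent_right_fix h360 hG hG'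
  exact twoSided_series b₀ b₁ b₂ E Aop d δ₀ α θ θA A₁ A₂ C_T M₀ W W₀ Vw V' Q hθ hθA hA₁ hA₂ hC hM₀ hW hW₀ hVw hV'
    hQ hαδ h2αδ htri hrefl hdnn hsymm h261 h263 hsmall hEG hEGA h363 h363A htransfer hfix hap

end TwoSided

end

end Literature.MathematicalPhysics.QuantumFieldTheory.Balaban1983to89.B9SectBAllNorms
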